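import Literature.Computability.AlgebraicComplexity.BorderRankMatMulThreeBlocks
import HarnessLib

/-!
# Borel-fixed candidates of `⟨3,3,3⟩`: the relabelings `σ₂`, `σ₃`

Topic `Literature/Computability/AlgebraicComplexity`. The product relabelings

* `MatMul3.σ₂ = f₂ × g₂ : (a, b) = ((i,k),(i',j)) ↦ ((rev k, i), (i', rev j)) ∈ B × C`,
* `MatMul3.σ₃ = f₃ × g₃ : (a, b) ↦ ((k, i), (rev j, i')) ∈ A × C`

identifying the coordinates of the `(011)`-member `E₂ ≤ B ⊗ C` and of the `(101)`-member
`E₃ ≤ A ⊗ C` of a candidate triple of `⟨3,3,3⟩` with the `(110)` coordinates of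
`BorderRankMatMulThreeBlocks.lean` (block `(j,k)`, position `(i,i')`, identity = a slice); used by
`BorderRankMatMulThreeTransportData.lean` (the moves in the new coordinates) and by the `(111)`
test (`BorderRankMatMulThreeTripleSound.lean`).

## References

* A. Conner, A. Harper, J. M. Landsberg, *New lower bounds for matrix multiplication and `det₃`*,
  Forum Math. Pi 11 (2023) e17, arXiv:1911.07981 — §2.5, §6. [ConnerHarperLandsberg2023]
-/

namespace Literature.Computability.AlgebraicComplexity

namespace BorderApolarity

namespace MatMul3

/-! ## The relabelings -/

/-- `A → B` part of `σ₂`: `(i,k) ↦ (rev k, i)`. [folklore] -/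
def f₂ (a : I9') : I9' := (a.2.rev, a.1)

/-- `B → C` part of `σ₂`: `(i',j) ↦ (i', rev j)`. [folklore] -/
def g₂ (b : I9') : I9' := (b.1, b.2.rev)

/-- `A → A` part of `σ₃`: `(i,k) ↦ (k, i)`. [folklore] -/
def f₃ (a : I9') : I9' := (a.2, a.1)

/-- `B → C` part of `σ₃`: `(i',j) ↦ (rev j, i')`. [folklore] -/
def g₃ (b : I9') : I9' := (b.2.rev, b.1)

/-- `(110)`-coordinates → `(011)`-coordinates. [folklore] -/
def σ₂ : I9' × I9' → I9' × I9' := Prod.map f₂ g₂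

/-- `(110)`-coordinates → `(101)`-coordinates. [folklore] -/
def σ₃ : I9' × I9' → I9' × I9' := Prod.map f₃ g₃

/-- `f₂` is a bijection. [folklore] -/
theorem f₂_bijective : Function.Bijective f₂ := by decide

/-- `g₂` is a bijection. [folklore] -/
theorem g₂_bijective : Function.Bijective g₂ := by decide

/-- `f₃` is a bijection. [folklore] -/
theorem f₃_bijective : Function.Bijective f₃ := by decide

/-- `g₃` is a bijection. [folklore] -/
theorem g₃_bijective : Function.Bijective g₃ := by decide

/-- `σ₂` is a bijection. [folklore] -/
theorem σ₂_bijective : Function.Bijective σ₂ := f₂_bijective.prodMap g₂_bijective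

/-- `σ₃` is a bijection. [folklore] -/
theorem σ₃_bijective : Function.Bijective σ₃ := f₃_bijective.prodMap g₃_bijective

end MatMul3

end BorderApolarity

end Literature.Computability.AlgebraicComplexity
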